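import Summits.HodgeConjecture.HodgeConjecture.Theorems.F0P3bLocalExpansionAtKitOfRecordS0   -- ★ (K4, 9e3034f68c6df352): `GTraceProductFormS₀`, `HTraceProductFormS₀` (+ `.mono`, `_empty_iff`), `localExpansion_kitOfRecord_S₀`; brings ★ V6 `localExpansion_at_of_productForm`
import Summits.HodgeConjecture.HodgeConjecture.Theorems.F0P3bLocalExpansionAtKitOfRecordW    -- ★2 (ED. 38 «PK-ε»; P3b desk instr2 52c41cb4a6cedd57, filed p847030): `GTraceProductFormW`, `gTrace_gauge`, `hTrace_gauge`; brings ★1 `kitOfRecordW`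
import HarnessLib

/-!
# `F0P3bLocalExpansionAtKitOfRecordS0W` — EDITION «W» of ★ `F0P3bLocalExpansionAtKitOfRecordS0`: the GUARDED G-side clause with the root-number sign, and the v8 law
# `LocalExpansion (kitOfRecordW … wXi c …) S₀` (closer ED. 38 «PK-ε»; Rogawski 1992 Thm. 1.2)

F0P3b desk (P3b hand F0P3b-p01 (g13); desk memo `F0/P3b/pkeps/PKEPS-P3b-position.v1.F0P3b-plan-g19.md` b086a430ac19212c §3 (c); RULING D53-pre f17dc03034ce6b66 PART A (4) ★3;
LEAD T11-69 (3), T11-71 (1)(b)).  ADDITIVE edition: ★ K4 `…S0` and ★ ED. 1 are untouched; the H-side guarded clause `HTraceProductFormS₀ … c …` is REUSED BY NAME (P3b (P6):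
the root number sits on the STABLE term only).

WHAT IS PROVED.  With `wXi : OneDimAutRepH L → ℤ` the per-ξ root-number sign (`wXi ξ = ε(½, φ_ξ)`, ∃-bound in the letter):
* `GTraceProductFormS₀W S₀ wXi` — ★ `GTraceProductFormS₀ S₀`'s text with the ONE factor `* (wXi ξ : ℂ)` after `(-1) ^ nCompactOfRecord L` (= ★2 `GTraceProductFormW` asked only at
  `S ⊇ S₀`); `gTraceProductFormS₀W_of` (unguarded ⇒ guarded), `GTraceProductFormS₀W.mono` (enlarging the guard), `gTraceProductFormS₀W_empty_iff` (`S₀ = ∅` ⇔ ★2's clause),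
  `gTraceProductFormS₀W_one_iff` (`wXi ≡ 1` ⇔ ★ K4's clause);
* **`localExpansion_kitOfRecordW_S₀`** — the v8 law `LocalExpansion (kitOfRecordW … wXi c …) S₀` from `wXi ξ = ±1`, `c = ±1`, `GTraceProductFormS₀W S₀ wXi` and the UNCHANGED
  `HTraceProductFormS₀ S₀ c` (★ V6 `localExpansion_at_of_productForm` after ★2's two gauges `gTrace_gauge`∕`hTrace_gauge`); `localExpansion_kitOfRecordW_S₀_of_productFormW` (fed by the
  unguarded clauses).
No `sorry`, no new axiom, no instance, no notation; Theorems never import Lines.  HONEST LABEL: HC_CM is proved only modulo the printed citations (2 remaining named inputs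
hLiu418 24832, h413 24833) until rung 0 closes; ED. 38 is count-neutral.
-/

set_option autoImplicit false
set_option linter.dupNamespace false

noncomputable section

open NumberField IsDedekindDomain MeasureTheory
open Literature.NumberTheory.Rogawski1990 Literature.NumberTheory.GaloisRepresentations
open Literature.NumberTheory.Automorphic Literature.NumberTheory.Automorphic.UnitaryGroup
open scoped Matrix ComplexOrder BigOperators Classical

namespace Summit.HodgeConjecture.HodgeConjecture.Cruxes.H413.F0P3bLocalExpansionAtKitOfRecordW

open Summit.HodgeConjecture.HodgeConjecture.Cruxes.H413.F0P3InnerFormClassificationV6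
open Summit.HodgeConjecture.HodgeConjecture.Cruxes.H413.F0P3InnerFormClassificationV6.ClassificationKit (memberCoeff)
open Summit.HodgeConjecture.HodgeConjecture.Cruxes.H413.F0P3SemilocalTestFunctionsOfRecord (TestS₀)
open Summit.HodgeConjecture.HodgeConjecture.Cruxes.H413.F0P3XiArchDataOfRecord (nCompactOfRecord)
open Summit.HodgeConjecture.HodgeConjecture.Cruxes.H413.F0P3XiArchPacketOfRecord (archPacketOfRecord)
open Summit.HodgeConjecture.HodgeConjecture.Cruxes.H413.F0P3KitOfRecord (GHSide XiSide cptXi₀ kitOfRecord)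
open Summit.HodgeConjecture.HodgeConjecture.Cruxes.H413.F0P3KitOfRecordW (kitOfRecordW kitOfRecordW_sgnG_eq_one_or_eq_neg_one)
open Summit.HodgeConjecture.HodgeConjecture.Cruxes.H413.F0P3bLocalExpansionOfProductFormV6 (localExpansion_at_of_productForm)
open Summit.HodgeConjecture.HodgeConjecture.Cruxes.H413.F0P3bLocalExpansionAtKitOfRecord
  (GTraceProductForm HTraceProductForm GTraceProductFormS₀ HTraceProductFormS₀ hTraceProductFormS₀_of)

variable (L : Type) [Field L] [NumberField L] [IsCMField L] (H : Matrix (Fin 3) (Fin 3) L) (ι : L →+* ℂ) (T : GL (Fin 3) ℂ)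
  (hT : (T : Matrix (Fin 3) (Fin 3) ℂ)ᴴ * H.map ι * (T : Matrix (Fin 3) (Fin 3) ℂ) = Literature.Geometry.ComplexHyperbolic.BallModel.J)
  (μ : Measure (Gp L H).automorphicQuotient) [(Gp L H).IsAutomorphicMeasure μ]

/-! ## §1 The guarded G-side clause WITH the root-number sign -/

section Clauses

variable {L H μ}
variable {PG PH : Type} (gh : GHSide L H ι T hT PG PH) (ξd : XiSide L H PG PH)
  (μω : HeckeCharacter L) (wXi : OneDimAutRepH L → ℤ) (jInf dsInf : ℤ → ℤ → ℤ → Cinf)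
  (archTr : Cinf → (UnitaryGroup.arch (↥(maximalRealSubfield L)) L (IsCMField.complexConj L) 3 H → ℂ) → ℂ)

/-- **`GTraceProductFormS₀W S₀ wXi`** — ★2 `GTraceProductFormW` asked only at the finite sets `S ⊇ S₀` (and `S ⊇ ram ξ`): the `S`-level trace of `Π(ξ)` is the compact
factor times `(−1)^N · (wXi ξ)` times the STABLE packet characters.  (= ★ K4 `GTraceProductFormS₀`'s text with the ONE factor `* (wXi ξ : ℂ)`.)
[cite: Rogawski1992, Thm. 1.2 p. 397; §6 p. 417] [cite: Rogawski1990, §13.1 13.1.3 (b) p. 199; §12.3 12.3.3 (b) p. 178; §14.6 p. 243 l. 3, p. 244] -/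
def GTraceProductFormS₀W (S₀ : Finset (Places L)) (μv : ∀ v : Places L, @Measure ((cmDatum L 3 H).Local v) (borel _)) : Prop :=
  ∀ (ξ : OneDimAutRepH L) (S : Finset (Places L)), S₀ ⊆ S → ξd.ram ξ ⊆ S →
    ∀ (fS : TestS₀ L H ι T hT S) (fSG : gh.TestSG S) (fSH : gh.TestSH S), gh.MatchesS S fS fSG fSH →
      gh.trGS S (ξd.PiXi ξ) fSG = (if cptXi₀ ι μω ξ then 1 else 0) * (-1) ^ nCompactOfRecord L * (wXi ξ : ℂ) *
        ((∑ᶠ y, (memberCoeff (archPacketOfRecord ι μω jInf dsInf ξ) (-1) y : ℂ) * archTr y fS.arch) *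
          ∏ v : ↥S, ∑ᶠ z, (memberCoeff (ξd.packFin ξ v.1) (-1) z : ℂ) *
            (letI : MeasurableSpace ((cmDatum L 3 H).Local v.1) := borel _; z.smoothTrace (μv v.1) (fS.loc v)))

variable (μv : ∀ v : Places L, @Measure ((cmDatum L 3 H).Local v) (borel _))

/-- RESTATED-WEAKER: ★2's unguarded W-row gives the guarded one at every `S₀`. [folklore] -/
theorem gTraceProductFormS₀W_of (S₀ : Finset (Places L)) (h : GTraceProductFormW ι T hT gh ξd μω wXi jInf dsInf archTr μv) :
    GTraceProductFormS₀W ι T hT gh ξd μω wXi jInf dsInf archTr S₀ μv :=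
  fun ξ S _ hS => h ξ S hS

/-- The guarded W-row is preserved under ENLARGING the guard. [folklore] -/
theorem GTraceProductFormS₀W.mono {S₀ S₀' : Finset (Places L)} (hle : S₀ ⊆ S₀')
    (h : GTraceProductFormS₀W ι T hT gh ξd μω wXi jInf dsInf archTr S₀ μv) : GTraceProductFormS₀W ι T hT gh ξd μω wXi jInf dsInf archTr S₀' μv :=
  fun ξ S hS₀ hS => h ξ S (hle.trans hS₀) hS

/-- At the EMPTY guard the guarded W-row IS ★2's row. [folklore] -/
theorem gTraceProductFormS₀W_empty_iff :
    GTraceProductFormS₀W ι T hT gh ξd μω wXi jInf dsInf archTr ∅ μv ↔ GTraceProductFormW ι T hT gh ξd μω wXi jInf dsInf archTr μv :=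
  ⟨fun h ξ S hS => h ξ S (Finset.empty_subset S) hS, fun h => gTraceProductFormS₀W_of ι T hT gh ξd μω wXi jInf dsInf archTr μv ∅ h⟩

/-- **At the trivial sign `wXi ≡ 1` the guarded W-row IS ★ K4's guarded row.** [cite: Rogawski1990, §14.6 p. 244] [cite: Rogawski1992, Thm. 1.2 p. 397] -/
theorem gTraceProductFormS₀W_one_iff (S₀ : Finset (Places L)) :
    GTraceProductFormS₀W ι T hT gh ξd μω (fun _ => 1) jInf dsInf archTr S₀ μv ↔ GTraceProductFormS₀ ι T hT gh ξd μω jInf dsInf archTr S₀ μv := by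
  refine forall_congr' fun ξ => forall_congr' fun S => forall_congr' fun _ => forall_congr' fun _ => forall_congr' fun fS => forall_congr' fun fSG =>
    forall_congr' fun fSH => forall_congr' fun _ => ?_
  rw [Int.cast_one, mul_one]

end Clauses

/-! ## §2 (L6) in v8 form `LocalExpansion (kitOfRecordW …) S₀` from the guarded clauses -/

section AtKitOfRecordW

variable {L H μ}
variable (𝔰 : Sockets L H μ) (gh : GHSide L H ι T hT 𝔰.PacketG 𝔰.PacketH) (ξd : XiSide L H 𝔰.PacketG 𝔰.PacketH)
  (μω : HeckeCharacter L) (wXi : OneDimAutRepH L → ℤ) (c : ℚ) (jInf dsInf : ℤ → ℤ → ℤ → Cinf)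
  (archTr : Cinf → (UnitaryGroup.arch (↥(maximalRealSubfield L)) L (IsCMField.complexConj L) 3 H → ℂ) → ℂ)
  [MeasurableSpace (Gp L H).Adelic] [BorelSpace (Gp L H).Adelic] (ν : Measure (Gp L H).Adelic) [IsFiniteMeasureOnCompacts ν]
  (μv : ∀ v : Places L, @Measure ((cmDatum L 3 H).Local v) (borel _))
  (ramCls₀ : DiscreteAutomorphicRep (Gp L H) μ → Set (Places L))

/-- **(L6) AT THE ROOT-NUMBER KIT, v8 GUARDED FORM.**  If `wXi ξ = ±1`, `c = ±1` (R-21) and `gh` satisfies the two product-trace clauses AT THE SETS `S ⊇ S₀`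
(`GTraceProductFormS₀W S₀ wXi`, `HTraceProductFormS₀ S₀ c`), then `LocalExpansion (kitOfRecordW … wXi c …) S₀` — `sgnG ξ = wXi ξ·c = ±1`, finiteness, and the corrected
two-term expansion (14.6.3) at every `ξ`, `S ⊇ S₀ ∪ ram ξ` and matched data (★ V6 pointwise algebra `localExpansion_at_of_productForm` fed with ★2's gauges
`gTrace_gauge`∕`hTrace_gauge`: `(−1)^(N+[wXi ξ = −1]) = (−1)^N·wXi ξ`, `(−1)^(N+[wXi ξ = −1])·(wXi ξ·c) = (−1)^N·c`). [cite: Rogawski1992, Thm. 1.2 p. 397; §6 p. 417] [cite: GerbelliGauthier2019, Thm. 22, Thm. 24, Rem. 25]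
[cite: Rogawski1990, §14.6 Thm. 14.6.4, (14.6.3) p. 244 ll. 6–17; p. 243 l. 3; §13.1 p. 199; §12.3 p. 178] -/
theorem localExpansion_kitOfRecordW_S₀ (S₀ : Finset (Places L)) (hw : ∀ ξ, wXi ξ = 1 ∨ wXi ξ = -1) (hc : c = 1 ∨ c = -1)
    (hG : GTraceProductFormS₀W ι T hT gh ξd μω wXi jInf dsInf archTr S₀ μv) (hH : HTraceProductFormS₀ ι T hT gh ξd μω c jInf dsInf archTr S₀ μv) :
    F0P3InnerFormClassificationV8.ClassificationKit.LocalExpansion (kitOfRecordW L H ι T hT μ 𝔰 gh ξd μω wXi c jInf dsInf archTr ν μv ramCls₀) S₀ := by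
  intro ξ S hS₀ hS
  refine ⟨kitOfRecordW_sgnG_eq_one_or_eq_neg_one L H ι T hT μ 𝔰 gh ξd μω wXi c jInf dsInf archTr ν μv ramCls₀ hw hc ξ, fun fS fSG fSH hm => ?_⟩
  exact localExpansion_at_of_productForm _ ξ S fS fSG fSH (fun y => archTr y fS.arch)
    (fun v z => (letI : MeasurableSpace ((cmDatum L 3 H).Local v.1) := borel _; z.smoothTrace (μv v.1) (fS.loc v)))
    (fun _ => rfl) (gTrace_gauge (hw ξ) (hG ξ S hS₀ hS fS fSG fSH hm)) (hTrace_gauge (hw ξ) (hH ξ S hS₀ hS fS fSG fSH hm))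

/-- The v8 law at the root-number kit through the guarded door, FED BY THE UNGUARDED CLAUSES (★2 `GTraceProductFormW`, ★ ED. 1 `HTraceProductForm`). [folklore] -/
theorem localExpansion_kitOfRecordW_S₀_of_productFormW (S₀ : Finset (Places L)) (hw : ∀ ξ, wXi ξ = 1 ∨ wXi ξ = -1) (hc : c = 1 ∨ c = -1)
    (hG : GTraceProductFormW ι T hT gh ξd μω wXi jInf dsInf archTr μv) (hH : HTraceProductForm ι T hT gh ξd μω c jInf dsInf archTr μv) :
    F0P3InnerFormClassificationV8.ClassificationKit.LocalExpansion (kitOfRecordW L H ι T hT μ 𝔰 gh ξd μω wXi c jInf dsInf archTr ν μv ramCls₀) S₀ :=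
  localExpansion_kitOfRecordW_S₀ ι T hT 𝔰 gh ξd μω wXi c jInf dsInf archTr ν μv ramCls₀ S₀ hw hc
    (gTraceProductFormS₀W_of ι T hT gh ξd μω wXi jInf dsInf archTr μv S₀ hG) (hTraceProductFormS₀_of ι T hT gh ξd μω c jInf dsInf archTr μv S₀ hH)

/-- **At the trivial sign, the ED. ≤ 37 guarded law**: from ★ K4's clauses, `LocalExpansion (kitOfRecordW … (fun _ => 1) c …) S₀` (consistency read-back). [folklore] -/
theorem localExpansion_kitOfRecordW_S₀_one (S₀ : Finset (Places L)) (hc : c = 1 ∨ c = -1)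
    (hG : GTraceProductFormS₀ ι T hT gh ξd μω jInf dsInf archTr S₀ μv) (hH : HTraceProductFormS₀ ι T hT gh ξd μω c jInf dsInf archTr S₀ μv) :
    F0P3InnerFormClassificationV8.ClassificationKit.LocalExpansion (kitOfRecordW L H ι T hT μ 𝔰 gh ξd μω (fun _ => 1) c jInf dsInf archTr ν μv ramCls₀) S₀ :=
  localExpansion_kitOfRecordW_S₀ ι T hT 𝔰 gh ξd μω (fun _ => 1) c jInf dsInf archTr ν μv ramCls₀ S₀ (fun _ => Or.inl rfl) hc
    ((gTraceProductFormS₀W_one_iff ι T hT gh ξd μω jInf dsInf archTr μv S₀).2 hG) hH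

end AtKitOfRecordW

end Summit.HodgeConjecture.HodgeConjecture.Cruxes.H413.F0P3bLocalExpansionAtKitOfRecordW

end
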